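import Literature.MathematicalPhysics.QuantumFieldTheory.Balaban1983to89.B5G183RateWThetaMixed

/-!
# B5G183RateWThetaMixedSharp — order two, `U = 1`, weights `W^θ∂_ν ⊗ W^θ∂_{ν′}` in MIXED directions
`ν ≠ ν′`: the exponent `4θ` is SHARP (`0 ≤ θ < 1/2`, `d ≥ 2`)

[cite: Balaban1984PropagatorsI, Prop. 1.1 (1.89) p.33, (1.83) p.31; King1986, (4.19)–(4.20), (4.23)
p.672, (4.24) p.673] [folklore]

Bałaban, *Propagators and renormalization transformations for lattice gauge theories. I*, CMP 95
(1984), p.33: «Proposition 1.1. The operator G is a symmetric operator on L²(T_η) and ‖GJ‖, ‖∇GJ‖,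
‖G∇*J‖, ‖∇G∇*J‖, ‖∇∇GJ‖, ‖G∇*∇*J‖ ≤ γ₀⁻¹‖J‖, (1.89) with a positive constant γ₀ independent of k,
T_η, and depending on d only (if we put a = 1).»  Bałaban prints NO rate in `η = L^{−k}`; the eta-rate
currencies of this directory (`OrderTwoOpRateResidualWθ`, `OrderTwoOpRateResidualWθoff`) and every
constant below are OURS (finite torus, `U = 1`, the linear theory only).  King [King1986], CMP 102 (1986) 649–677, (4.20)
p.672 supplies the alias weight `W = ∏_μ |p′_μ|/|p′_μ + 2πj_μ|` whose real power `W^θ` multiplies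
each derivative symbol.

WHAT IS PROVED.  `B5G183RateWThetaMixed.orderTwoOpRateResidualWθoff_holds` gives the mixed-direction
(`ν ≠ ν′`) order-two residual the exponent `min(4θ, 1)`.  Here: for `d ≥ 2` (two distinct directions
`μ₁ ≠ μ₂`), `a > 0`, `0 ≤ θ < 1/2` and EVERY constant `C`, the mixed currency FAILS for every exponent
`γ > 4θ` (`not_orderTwoOpRateResidualWθoff_of_lt`); hence for `0 ≤ θ ≤ 1/4` the mixed exponent `4θ`
is SHARP: `(∃ C, OrderTwoOpRateResidualWθoff d a C θ γ) ↔ γ ≤ 4θ` (`orderTwoOpRateWθoff_iff`) — double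
the sharp all-directions exponent `2θ` of `B5G183RateWThetaHolds.orderTwoOpRateWθ_iff`.

WITNESS.  `R = 2`, fibre `p′ = π(e_{μ₁} + e_{μ₂})`, the level-`2N` class `K = (N−1)(e_{μ₁} + e_{μ₂})`
(`N = M + 2`): it is one of King's `|m| ≥ 1` classes (no level-`N` class is planted on its row,
`KW2_unpaired`), its symmetric representative is `q̃_K = π(2N−1)(e_{μ₁} + e_{μ₂})`, so BOTH active
weight factors are small, `W(K) = (1/(2N−1))²` (`Wc_KW2`), the two derivative symbols `∂_{μ₁}(q̃_K) =
∂_{μ₂}(q̃_K)` coincide (`dSym_KW2_snd_eq`), and the `((K,μ₁),(K,μ₁))` entry of the level-`2N` mixed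
sandwich is `(W^θ)²·|∂_{μ₁}|²/Δ + junk = (1/(2N−1))^{4θ}/2 + O(1/N²)` (`main_KW2`, `junk_KW2_le` via
`B5G183RateObstructionOp.junk_le`).  An operator bound `C/N^γ` dominates this entry
(`SolovayKitaev.norm_apply_le_norm`), and `(2N−1)^{−4θ}/2 ≥ (1/8)N^{−4θ}` beats `C/N^γ + Cj/N²` for
`N` large once `γ > 4θ` and `4θ < 2` (`numeric_core8`).

NOT CLAIMED: anything for `θ ≥ 1/2`; for `θ ∈ (1/4, 1/2)` the exponents in `(1, 4θ]` are left open
(the positive side gives `1`, this module excludes `γ > 4θ`); `d = 1` (no mixed directions); sharpness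
of the rate `1/N` of the finite-rank pieces; `U ≠ 1`; constants.  NOT summit progress.
-/

noncomputable section

namespace Literature.MathematicalPhysics.QuantumFieldTheory.Balaban1983to89.B5G183RateWThetaMixedSharp

open scoped BigOperators ComplexConjugate Matrix.Norms.L2Operator
open Finset Complex
open Literature.MathematicalPhysics.QuantumFieldTheory.Balaban1983to89.B4Strip
open Literature.MathematicalPhysics.QuantumFieldTheory.Balaban1983to89.B5Prop11Fiber
open Literature.MathematicalPhysics.QuantumFieldTheory.Balaban1983to89.B5Prop11Bound
open Literature.MathematicalPhysics.QuantumFieldTheory.Balaban1983to89.B5Hk163Rate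
open Literature.MathematicalPhysics.QuantumFieldTheory.Balaban1983to89.B5Hk163RateSum
open Literature.MathematicalPhysics.QuantumFieldTheory.Balaban1983to89.B5G183Rate
open Literature.MathematicalPhysics.QuantumFieldTheory.Balaban1983to89.B5G183RateSum
open Literature.MathematicalPhysics.QuantumFieldTheory.Balaban1983to89.B5G183RateL2
open Literature.MathematicalPhysics.QuantumFieldTheory.Balaban1983to89.B5G183RateOp
open Literature.MathematicalPhysics.QuantumFieldTheory.Balaban1983to89.B5G183RateObstruction
open Literature.MathematicalPhysics.QuantumFieldTheory.Balaban1983to89.B5G183RateObstructionOp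
open Literature.MathematicalPhysics.QuantumFieldTheory.Balaban1983to89.B5G183RateO2Diag
open Literature.MathematicalPhysics.QuantumFieldTheory.Balaban1983to89.B5G183RateO2Op
open Literature.MathematicalPhysics.QuantumFieldTheory.Balaban1983to89.B5G183RateWTheta
open Literature.MathematicalPhysics.QuantumFieldTheory.Balaban1983to89.B5G183RateWThetaSharp
open Literature.MathematicalPhysics.QuantumFieldTheory.Balaban1983to89.B5G183RateWThetaHolds
open Literature.MathematicalPhysics.QuantumFieldTheory.Balaban1983to89.B5G183RateWThetaMixed
open Literature.MathematicalPhysics.QuantumFieldTheory.King1986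
open Literature.Computability.QuantumComplexity.SolovayKitaev (norm_apply_le_norm)

variable {d : ℕ}

/-! ## §1 The witness class `K = (N−1)(e_{μ₁} + e_{μ₂})` of level `2N`, `N = M + 2` [folklore] -/

section Witness

/-- the fibre `p′ = π(e_{μ₁} + e_{μ₂})`. [folklore] -/
def sWit2 (μ₁ μ₂ : Fin d) : Fin d → ℝ := fun μ => if μ = μ₁ ∨ μ = μ₂ then Real.pi else 0

/-- `sWit2` lies in the zone and is nonzero. [folklore] -/
theorem sWit2_zone_ne_zero (μ₁ μ₂ : Fin d) :
    (∀ μ, |sWit2 μ₁ μ₂ μ| ≤ Real.pi) ∧ sWit2 μ₁ μ₂ ≠ 0 := by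
  refine ⟨fun μ => ?_, fun h => ?_⟩
  · unfold sWit2
    split_ifs
    · rw [abs_of_pos Real.pi_pos]
    · rw [abs_zero]; exact Real.pi_pos.le
  · have := congrFun h μ₁
    simp [sWit2, Real.pi_ne_zero] at this

/-- its `μ₁`-coordinate `π ≠ 0`. [folklore] -/
theorem sWit2_fst_ne_zero (μ₁ μ₂ : Fin d) : sWit2 μ₁ μ₂ μ₁ ≠ 0 := by
  simp [sWit2, Real.pi_ne_zero]

/-- the level-`2N` class `(N−1)(e_{μ₁} + e_{μ₂})`, `N = M + 2`. [folklore] -/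
def KW2 (M : ℕ) (μ₁ μ₂ : Fin d) : Fin d → Fin (2 * (M + 2)) :=
  fun μ => if μ = μ₁ ∨ μ = μ₂ then ⟨M + 1, by omega⟩ else ⟨0, by omega⟩

/-- its shifted momentum `p′ + 2πK = π(2N−1)(e_{μ₁} + e_{μ₂})`. [folklore] -/
theorem shiftr_KW2 (M : ℕ) (μ₁ μ₂ μ : Fin d) :
    shiftr (2 * (M + 2)) (KW2 M μ₁ μ₂) (sWit2 μ₁ μ₂) μ
      = if μ = μ₁ ∨ μ = μ₂ then Real.pi * (2 * M + 3) else 0 := by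
  unfold shiftr sWit2 KW2
  split_ifs with h
  · push_cast; ring
  · push_cast; ring

/-- no folding: `π(2N−1) ≤ π·2N`, so King's pull-back count vanishes. [cite: King1986, (4.19) p.672]
[folklore] -/
theorem symmShift_KW2 (M : ℕ) (μ₁ μ₂ μ : Fin d) :
    symmShift (2 * (M + 2)) (KW2 M μ₁ μ₂) (sWit2 μ₁ μ₂) μ = 0 := by
  unfold symmShift
  rw [shiftr_KW2, if_neg]
  have hM : (0 : ℝ) ≤ M := Nat.cast_nonneg M
  have hπ := Real.pi_pos
  split_ifs
  · push_cast; nlinarith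
  · exact not_lt.mpr (by positivity)

/-- the symmetric representative `q̃_K = π(2N−1)(e_{μ₁} + e_{μ₂})`. [cite: King1986, (4.19) p.672]
[folklore] -/
theorem symmAlias_KW2 (M : ℕ) (μ₁ μ₂ μ : Fin d) :
    symmAlias (2 * (M + 2)) (KW2 M μ₁ μ₂) (sWit2 μ₁ μ₂) μ
      = if μ = μ₁ ∨ μ = μ₂ then Real.pi * (2 * M + 3) else 0 := by
  unfold symmAlias
  rw [symmShift_KW2, shiftr_KW2]
  push_cast
  ring

/-- King's integer label `j = (N−1)(e_{μ₁} + e_{μ₂})`. [folklore] -/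
theorem jOf_KW2 (M : ℕ) (μ₁ μ₂ μ : Fin d) :
    jOf (2 * (M + 2)) (KW2 M μ₁ μ₂) (sWit2 μ₁ μ₂) μ = if μ = μ₁ ∨ μ = μ₂ then ((M : ℤ) + 1) else 0 := by
  unfold jOf
  rw [symmShift_KW2]
  unfold KW2
  split_ifs <;> simp

/-- `j ≠ 0`. [folklore] -/
theorem jOf_KW2_ne_zero (M : ℕ) (μ₁ μ₂ : Fin d) :
    jOf (2 * (M + 2)) (KW2 M μ₁ μ₂) (sWit2 μ₁ μ₂) ≠ 0 := by
  intro h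
  have h1 := congrFun h μ₁
  rw [jOf_KW2, if_pos (Or.inl rfl), Pi.zero_apply] at h1
  omega

/-- **`K` is one of King's `|m| ≥ 1` classes:** it is not `ι₂ k` for any level-`N` class `k`
(`|q̃_{K,μ₁}| = π(2N−1) > πN`). [cite: King1986, (4.19), (4.24) pp.672–673] [folklore] -/
theorem KW2_unpaired (M : ℕ) (μ₁ μ₂ : Fin d) :
    ∀ k : Fin d → Fin (M + 2), iota 2 k (sWit2 μ₁ μ₂) ≠ KW2 M μ₁ μ₂ := by
  intro k hk
  have hN : 1 ≤ M + 2 := by omega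
  have hs := (sWit2_zone_ne_zero μ₁ μ₂).1
  have hz := (isRep_symmAlias hN k hs).zone μ₁
  rw [← symmAlias_iota (R := 2) hN k hs, hk, symmAlias_KW2, if_pos (Or.inl rfl),
    abs_of_pos (by positivity)] at hz
  push_cast at hz
  have hM : (0 : ℝ) ≤ M := Nat.cast_nonneg M
  nlinarith [Real.pi_pos]

/-- **its King weight has TWO small factors:** `W = (|π|/|π + 2π(N−1)|)² = (1/(2N−1))²` (`μ₁ ≠ μ₂`).
[cite: King1986, (4.20) p.672] [folklore] -/
theorem Wc_KW2 (M : ℕ) {μ₁ μ₂ : Fin d} (hne : μ₁ ≠ μ₂) :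
    Wc (2 * (M + 2)) (KW2 M μ₁ μ₂) (sWit2 μ₁ μ₂) = ((1 : ℝ) / (2 * M + 3)) ^ 2 := by
  have hπ := Real.pi_pos
  have hM : (0 : ℝ) ≤ M := Nat.cast_nonneg M
  -- the generic factor of King's product
  have hfac : ∀ μ, (μ = μ₁ ∨ μ = μ₂) →
      (if jOf (2 * (M + 2)) (KW2 M μ₁ μ₂) (sWit2 μ₁ μ₂) μ = 0 then (1 : ℝ)
        else |sWit2 μ₁ μ₂ μ|
          / |sWit2 μ₁ μ₂ μ + 2 * Real.pi * (jOf (2 * (M + 2)) (KW2 M μ₁ μ₂) (sWit2 μ₁ μ₂) μ : ℝ)|)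
        = 1 / (2 * M + 3) := by
    intro μ h
    rw [jOf_KW2, if_pos h, if_neg (by omega)]
    unfold sWit2
    rw [if_pos h]
    push_cast
    rw [abs_of_pos hπ, abs_of_pos (by positivity)]
    field_simp
    ring
  have hone : ∀ μ ∈ (Finset.univ.erase μ₁).erase μ₂,
      (if jOf (2 * (M + 2)) (KW2 M μ₁ μ₂) (sWit2 μ₁ μ₂) μ = 0 then (1 : ℝ)
        else |sWit2 μ₁ μ₂ μ|
          / |sWit2 μ₁ μ₂ μ + 2 * Real.pi * (jOf (2 * (M + 2)) (KW2 M μ₁ μ₂) (sWit2 μ₁ μ₂) μ : ℝ)|)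
        = 1 := by
    intro μ hμ
    have h2 := Finset.mem_erase.mp hμ
    have h1 := Finset.mem_erase.mp h2.2
    rw [jOf_KW2, if_neg (not_or.mpr ⟨h1.1, h2.1⟩), if_pos rfl]
  unfold Wc aliasWeight
  rw [← Finset.mul_prod_erase Finset.univ _ (Finset.mem_univ μ₁),
    ← Finset.mul_prod_erase (Finset.univ.erase μ₁) _ (Finset.mem_erase.mpr ⟨hne.symm, Finset.mem_univ μ₂⟩),
    Finset.prod_eq_one hone, mul_one, hfac μ₁ (Or.inl rfl), hfac μ₂ (Or.inr rfl)]
  ring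

/-- `|∂^{(2N)}_{μ}(q̃_K)|² = S^{(2N)}(π(2N−1))` in both active coordinates. [folklore] -/
theorem normSq_dSym_KW2 (M : ℕ) {μ₁ μ₂ μ : Fin d} (h : μ = μ₁ ∨ μ = μ₂) :
    ‖dSym (2 * (M + 2)) (KW2 M μ₁ μ₂) (sWit2 μ₁ μ₂) μ‖ ^ 2
      = Sxir (2 * (M + 2)) (Real.pi * (2 * M + 3)) := by
  rw [norm_dSym_sq, shiftr_KW2, if_pos h]

/-- **the two derivative symbols coincide at the witness:** `∂_{μ₂}(q̃_K) = ∂_{μ₁}(q̃_K)` (equal active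
coordinates). [cite: Balaban1984PropagatorsI, (1.31) p.23] [folklore] -/
theorem dSym_KW2_snd_eq (M : ℕ) (μ₁ μ₂ : Fin d) :
    dSym (2 * (M + 2)) (KW2 M μ₁ μ₂) (sWit2 μ₁ μ₂) μ₂
      = dSym (2 * (M + 2)) (KW2 M μ₁ μ₂) (sWit2 μ₁ μ₂) μ₁ := by
  simp [dSym, shiftr_KW2]

/-- hence also the weighted ones: `W^θ∂_{μ₂}(q̃_K) = W^θ∂_{μ₁}(q̃_K)`. [folklore] -/
theorem wθdSym_KW2_snd_eq (M : ℕ) (μ₁ μ₂ : Fin d) (θ : ℝ) :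
    wθdSym (2 * (M + 2)) θ (KW2 M μ₁ μ₂) (sWit2 μ₁ μ₂) μ₂
      = wθdSym (2 * (M + 2)) θ (KW2 M μ₁ μ₂) (sWit2 μ₁ μ₂) μ₁ := by
  unfold wθdSym
  rw [dSym_KW2_snd_eq]

/-- `Δ^{(2N)}(q̃_K) = 2·S^{(2N)}(π(2N−1))` (massless, two equal nonzero coordinates, `μ₁ ≠ μ₂`).
[folklore] -/
theorem DeltaXir_KW2 (M : ℕ) {μ₁ μ₂ : Fin d} (hne : μ₁ ≠ μ₂) :
    DeltaXir (2 * (M + 2)) 0 (symmAlias (2 * (M + 2)) (KW2 M μ₁ μ₂) (sWit2 μ₁ μ₂))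
      = 2 * Sxir (2 * (M + 2)) (Real.pi * (2 * M + 3)) := by
  unfold DeltaXir
  rw [add_zero, ← Finset.add_sum_erase Finset.univ _ (Finset.mem_univ μ₁),
    ← Finset.add_sum_erase (Finset.univ.erase μ₁) _
      (Finset.mem_erase.mpr ⟨hne.symm, Finset.mem_univ μ₂⟩),
    symmAlias_KW2, if_pos (Or.inl rfl), symmAlias_KW2, if_pos (Or.inr rfl),
    Finset.sum_eq_zero (fun μ hμ => by
      have h2 := Finset.mem_erase.mp hμ
      have h1 := Finset.mem_erase.mp h2.2
      rw [symmAlias_KW2, if_neg (not_or.mpr ⟨h1.1, h2.1⟩), B5G183RateObstruction.Sxir_zero]),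
    add_zero]
  ring

/-- **the main term:** `(|W^θ∂_{μ₁}(q̃_K)|²)·Δ(q̃_K)⁻¹ = ((1/(2N−1))²)^{2θ}/2`. [folklore] -/
theorem main_KW2 (M : ℕ) {μ₁ μ₂ : Fin d} (hne : μ₁ ≠ μ₂) (θ : ℝ) :
    ((‖wθdSym (2 * (M + 2)) θ (KW2 M μ₁ μ₂) (sWit2 μ₁ μ₂) μ₁‖ ^ 2 : ℝ) : ℂ)
        * (((DeltaXir (2 * (M + 2)) 0 (symmAlias (2 * (M + 2)) (KW2 M μ₁ μ₂) (sWit2 μ₁ μ₂)) : ℝ) : ℂ))⁻¹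
      = ((((((1 : ℝ) / (2 * M + 3)) ^ 2) ^ θ) ^ 2 / 2 : ℝ) : ℂ) := by
  have hS := Sxir_KW_pos M
  have hW0 : 0 ≤ Wc (2 * (M + 2)) (KW2 M μ₁ μ₂) (sWit2 μ₁ μ₂) :=
    (Wc_nonneg_le_one (n := 2 * (M + 2)) (KW2 M μ₁ μ₂) (sWit2_zone_ne_zero μ₁ μ₂).1).1
  rw [← Complex.ofReal_inv, ← Complex.ofReal_mul, DeltaXir_KW2 M hne]
  congr 1
  unfold wθdSym
  rw [norm_mul, mul_pow, Complex.norm_real, Real.norm_eq_abs,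
    abs_of_nonneg (Real.rpow_nonneg hW0 θ), normSq_dSym_KW2 M (Or.inl rfl), Wc_KW2 M hne]
  generalize Sxir (2 * (M + 2)) (Real.pi * (2 * M + 3)) = S at hS ⊢
  field_simp

/-- **the junk** (x-corner and bracket of (1.83) at the witness class, times `|W^θ∂|²`) is `≤ Cj/N²`
(`B5G183RateObstructionOp.junk_le` with `L = ‖q̃_K‖_∞ = π(2N−1)`, `|W^θ∂|² ≤ |∂|² ≤ L²`).
[cite: Balaban1984PropagatorsI, (1.83) p.31; King1986, (4.20) p.672] [folklore] -/
theorem junk_KW2_le (M : ℕ) (μ₁ μ₂ : Fin d) (a : ℝ) (ha : 0 < a) {θ : ℝ} (hθ : 0 ≤ θ) :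
    ‖((‖wθdSym (2 * (M + 2)) θ (KW2 M μ₁ μ₂) (sWit2 μ₁ μ₂) μ₁‖ ^ 2 : ℝ) : ℂ)
        * (rEnt (2 * (M + 2)) a μ₁ μ₁ (sWit2 μ₁ μ₂) (KW2 M μ₁ μ₂) (KW2 M μ₁ μ₂)
            - xEnt (2 * (M + 2)) a μ₁ (sWit2 μ₁ μ₂) (KW2 M μ₁ μ₂) (KW2 M μ₁ μ₂))‖
      ≤ Cjunk d a / ((M + 2 : ℕ) : ℝ) ^ 2 := by
  have hs := (sWit2_zone_ne_zero μ₁ μ₂).1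
  have hn : 1 ≤ 2 * (M + 2) := by omega
  have hπ := Real.pi_pos
  have hM : (0 : ℝ) ≤ M := Nat.cast_nonneg M
  have hγ := T4GaugeActionRate.gam0_pos d
  set L : ℝ := Real.pi * (2 * M + 3) with hL
  have hL0 : 0 < L := by positivity
  have hw : ‖wθdSym (2 * (M + 2)) θ (KW2 M μ₁ μ₂) (sWit2 μ₁ μ₂) μ₁‖ ^ 2 ≤ L ^ 2 :=
    calc ‖wθdSym (2 * (M + 2)) θ (KW2 M μ₁ μ₂) (sWit2 μ₁ μ₂) μ₁‖ ^ 2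
        ≤ ‖dSym (2 * (M + 2)) (KW2 M μ₁ μ₂) (sWit2 μ₁ μ₂) μ₁‖ ^ 2 :=
          pow_le_pow_left₀ (norm_nonneg _) (norm_wθdSym_le hθ _ hs μ₁) 2
      _ = Sxir (2 * (M + 2)) L := normSq_dSym_KW2 M (Or.inl rfl)
      _ ≤ L ^ 2 := Sxir_le _ _
  have hk := jOf_KW2_ne_zero M μ₁ μ₂
  have hq : ‖symmAlias (2 * (M + 2)) (KW2 M μ₁ μ₂) (sWit2 μ₁ μ₂)‖ = L := by
    apply le_antisymm
    · refine (pi_norm_le_iff_of_nonneg hL0.le).mpr fun μ => ?_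
      rw [Real.norm_eq_abs, symmAlias_KW2]
      split_ifs
      · rw [abs_of_pos hL0]
      · rw [abs_zero]; exact hL0.le
    · have h := norm_le_pi_norm (symmAlias (2 * (M + 2)) (KW2 M μ₁ μ₂) (sWit2 μ₁ μ₂)) μ₁
      rwa [symmAlias_KW2, if_pos (Or.inl rfl), Real.norm_eq_abs, abs_of_pos hL0] at h
  have hW1 := aliasWeight_le_one hs (jOf (2 * (M + 2)) (KW2 M μ₁ μ₂) (sWit2 μ₁ μ₂))
  have hx : xM (2 * (M + 2)) (sWit2 μ₁ μ₂) μ₁ (KW2 M μ₁ μ₂) ≤ CXa d / L ^ 2 := by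
    refine (xM_le_W_div_sq hs μ₁ hk).trans ?_
    rw [hq]
    exact div_le_div_of_nonneg_right
      (by simpa using mul_le_mul_of_nonneg_left hW1 (CXa_nonneg d)) (by positivity)
  have hb : bM (2 * (M + 2)) a (sWit2 μ₁ μ₂) μ₁ (KW2 M μ₁ μ₂) ≤ CBa d / L ^ 2 := by
    refine (bM_le_W_div_sq hn a hs μ₁ hk).trans ?_
    rw [hq]
    exact div_le_div_of_nonneg_right
      (by simpa using mul_le_mul_of_nonneg_left hW1 (CBa_nonneg d)) (by positivity)
  have h := junk_le hn a ha hs μ₁ (sWit2_fst_ne_zero μ₁ μ₂) μ₁ (KW2 M μ₁ μ₂) _ hL0 hw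
    (CXa_nonneg d) (CBa_nonneg d) hx hb
  refine h.trans ?_
  have e : ((4 * d + a) / a * CBa d ^ 2 + 4 * d / T4GaugeActionRate.gam0 d * CXa d ^ 2) / L ^ 2
      = Cjunk d a / (2 * M + 3) ^ 2 := by
    rw [hL, Cjunk, div_div, ← mul_pow]
  rw [e]
  refine div_le_div_of_nonneg_left (Cjunk_nonneg d ha) (by positivity) ?_
  push_cast
  nlinarith

/-- the planted order-two `W^θ` difference at the witness: `R = 2`, level `N = M+2`, fibre
`π(e_{μ₁} + e_{μ₂})`, MIXED directions `(μ₁, μ₂)`. [folklore] -/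
def XW2 (M : ℕ) [NeZero (M + 2)] (μ₁ μ₂ : Fin d) (a : ℝ) (ha : 0 < a) (θ : ℝ) :
    Matrix ((Fin d → Fin (2 * (M + 2))) × Fin d) ((Fin d → Fin (2 * (M + 2))) × Fin d) ℂ :=
  sandwich (fun K => wθdSym (2 * (M + 2)) θ K (sWit2 μ₁ μ₂) μ₁)
      (fun K => wθdSym (2 * (M + 2)) θ K (sWit2 μ₁ μ₂) μ₂)
      (balabanFiber (2 * (M + 2)) (by omega) a ha (sWit2 μ₁ μ₂) (sWit2_zone_ne_zero μ₁ μ₂).1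
        (sWit2_zone_ne_zero μ₁ μ₂).2).G
    - plant 2 (sWit2 μ₁ μ₂) (sandwich (fun k => wθdSym (M + 2) θ k (sWit2 μ₁ μ₂) μ₁)
        (fun k => wθdSym (M + 2) θ k (sWit2 μ₁ μ₂) μ₂)
        (balabanFiber (M + 2) (by omega) a ha (sWit2 μ₁ μ₂) (sWit2_zone_ne_zero μ₁ μ₂).1
          (sWit2_zone_ne_zero μ₁ μ₂).2).G)

/-- an `OrderTwoOpRateResidualWθoff` bound specialised to the witness (`μ₁ ≠ μ₂`). [folklore] -/
theorem opNorm_XW2_le {a C θ γ : ℝ} (h : OrderTwoOpRateResidualWθoff d a C θ γ) (M : ℕ)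
    [NeZero (M + 2)] {μ₁ μ₂ : Fin d} (hne : μ₁ ≠ μ₂) (ha : 0 < a) :
    ‖XW2 M μ₁ μ₂ a ha θ‖ ≤ C / ((M + 2 : ℕ) : ℝ) ^ γ :=
  h (M + 2) 2 (by omega) (by omega) ha (sWit2 μ₁ μ₂) (sWit2_zone_ne_zero μ₁ μ₂).1
    (sWit2_zone_ne_zero μ₁ μ₂).2 μ₁ μ₂ hne (by norm_num)

/-- **the witness entry of `XW2`:** the planted term vanishes on the row of the unpaired class `K`, and
the level-`2N` sandwich entry is `W^θ∂_{μ₁}·G^{(2N)}(K,K)_{μ₁μ₁}·conj(W^θ∂_{μ₂})`. [folklore] -/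
theorem XW2_entry (M : ℕ) [NeZero (M + 2)] (μ₁ μ₂ : Fin d) (a : ℝ) (ha : 0 < a) (θ : ℝ) :
    XW2 M μ₁ μ₂ a ha θ (KW2 M μ₁ μ₂, μ₁) (KW2 M μ₁ μ₂, μ₁)
      = wθdSym (2 * (M + 2)) θ (KW2 M μ₁ μ₂) (sWit2 μ₁ μ₂) μ₁
          * Gfor (2 * (M + 2)) a (sWit2 μ₁ μ₂) μ₁ μ₁ (KW2 M μ₁ μ₂) (KW2 M μ₁ μ₂)
          * conj (wθdSym (2 * (M + 2)) θ (KW2 M μ₁ μ₂) (sWit2 μ₁ μ₂) μ₂) := by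
  unfold XW2
  rw [Matrix.sub_apply, plant_row_unpaired _ (KW2_unpaired M μ₁ μ₂), sub_zero]
  simp only [sandwich, G_entry]

end Witness

/-! ## §2 The numeric core and the theorem [folklore] -/

section NoGo

/-- numeric core: `1/(8N^α) ≤ C/N^γ + Cj/N²` is impossible for `N ≥ (16|C|+1)^{1/(γ−α)}`,
`N ≥ (16Cj+1)^{1/(2−α)}`, `N ≥ 2` (`γ > α`, `α < 2`). [folklore] -/
theorem numeric_core8 {C Cj N α γ : ℝ} (hN : 2 ≤ N) (hα : α < 2) (hγ : α < γ) (hCj : 0 ≤ Cj)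
    (hm : 1 / (8 * N ^ α) ≤ C / N ^ γ + Cj / N ^ 2)
    (hT₁ : (16 * |C| + 1) ^ (1 / (γ - α)) ≤ N) (hT₂ : (16 * Cj + 1) ^ (1 / (2 - α)) ≤ N) :
    False := by
  have hN0 : 0 < N := by linarith
  set ε₁ := γ - α with hε₁d
  set ε₂ := 2 - α with hε₂d
  have hε₁ : 0 < ε₁ := by rw [hε₁d]; linarith
  have hε₂ : 0 < ε₂ := by rw [hε₂d]; linarith
  have hP : 0 < N ^ α := Real.rpow_pos_of_pos hN0 _
  have hE₁ : 0 < N ^ ε₁ := Real.rpow_pos_of_pos hN0 _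
  have hE₂ : 0 < N ^ ε₂ := Real.rpow_pos_of_pos hN0 _
  have h1 : 16 * |C| + 1 ≤ N ^ ε₁ := by
    have h0 : 0 ≤ 16 * |C| + 1 := by positivity
    calc 16 * |C| + 1 = ((16 * |C| + 1) ^ (1 / ε₁)) ^ ε₁ := by
          rw [← Real.rpow_mul h0, one_div_mul_cancel hε₁.ne', Real.rpow_one]
      _ ≤ N ^ ε₁ := Real.rpow_le_rpow (Real.rpow_nonneg h0 _) hT₁ hε₁.le
  have h2 : 16 * Cj + 1 ≤ N ^ ε₂ := by
    have h0 : 0 ≤ 16 * Cj + 1 := by positivity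
    calc 16 * Cj + 1 = ((16 * Cj + 1) ^ (1 / ε₂)) ^ ε₂ := by
          rw [← Real.rpow_mul h0, one_div_mul_cancel hε₂.ne', Real.rpow_one]
      _ ≤ N ^ ε₂ := Real.rpow_le_rpow (Real.rpow_nonneg h0 _) hT₂ hε₂.le
  have hγsplit : N ^ γ = N ^ α * N ^ ε₁ := by
    rw [← Real.rpow_add hN0]; congr 1; rw [hε₁d]; ring
  have h2split : N ^ (2 : ℕ) = N ^ α * N ^ ε₂ := by
    rw [← Real.rpow_natCast, ← Real.rpow_add hN0]; congr 1; rw [hε₂d]; push_cast; ring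
  rw [hγsplit, h2split] at hm
  have hm' : 1 ≤ 8 * (C / N ^ ε₁) + 8 * (Cj / N ^ ε₂) := by
    have h := mul_le_mul_of_nonneg_left hm (by positivity : (0 : ℝ) ≤ 8 * N ^ α)
    have e1 : 8 * N ^ α * (1 / (8 * N ^ α)) = 1 := by
      field_simp
    have e2 : 8 * N ^ α * (C / (N ^ α * N ^ ε₁) + Cj / (N ^ α * N ^ ε₂))
        = 8 * (C / N ^ ε₁) + 8 * (Cj / N ^ ε₂) := by
      field_simp
    rwa [e1, e2] at h
  have hc1 : C / N ^ ε₁ < 1 / 16 := by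
    calc C / N ^ ε₁ ≤ |C| / N ^ ε₁ := div_le_div_of_nonneg_right (le_abs_self C) hE₁.le
      _ < 1 / 16 := by rw [div_lt_iff₀ hE₁]; linarith
  have hc2 : Cj / N ^ ε₂ < 1 / 16 := by rw [div_lt_iff₀ hE₂]; linarith
  linarith

/-- **ORDER TWO, WEIGHTS `W^θ∂_{μ₁} ⊗ W^θ∂_{μ₂}` IN MIXED DIRECTIONS `μ₁ ≠ μ₂`: NO eta-rate `N^{−γ}`
WITH `γ > 4θ` (`0 ≤ θ < 1/2`, `d ≥ 2`, `a > 0`, every constant `C`).**  Witness: `R = 2`, fibre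
`p′ = π(e_{μ₁} + e_{μ₂})`, the unpaired class `K = (N−1)(e_{μ₁} + e_{μ₂})` of level `2N` — the planted
level-`N` term vanishes there and the level-`2N` entry `((K,μ₁),(K,μ₁))` is `(1/(2N−1))^{4θ}/2 +
O(N^{−2})`.  With `B5G183RateWThetaMixed.orderTwoOpRateResidualWθoff_holds` (exponent `min(4θ,1)`)
this makes the mixed exponent `4θ` SHARP on `[0, 1/4]`. [cite: Balaban1984PropagatorsI, Prop. 1.1 (1.89)
p.33, (1.83) p.31; King1986, (4.19)–(4.20), (4.23) p.672, (4.24) p.673] [folklore] -/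
theorem not_orderTwoOpRateResidualWθoff_of_lt {μ₁ μ₂ : Fin d} (hne : μ₁ ≠ μ₂) (a : ℝ) (ha : 0 < a)
    {C θ γ : ℝ} (hθ0 : 0 ≤ θ) (hθ2 : θ < 1 / 2) (hγ : 4 * θ < γ) :
    ¬ OrderTwoOpRateResidualWθoff d a C θ γ := by
  intro h
  have hCj := Cjunk_nonneg d ha
  have hα : 4 * θ < 2 := by linarith
  have hT₁0 : 0 ≤ (16 * |C| + 1) ^ (1 / (γ - 4 * θ)) := Real.rpow_nonneg (by positivity) _
  have hT₂0 : 0 ≤ (16 * Cjunk d a + 1) ^ (1 / (2 - 4 * θ)) := Real.rpow_nonneg (by positivity) _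
  obtain ⟨M, hM⟩ := exists_nat_ge ((16 * |C| + 1) ^ (1 / (γ - 4 * θ))
    + (16 * Cjunk d a + 1) ^ (1 / (2 - 4 * θ)))
  haveI : NeZero (M + 2) := ⟨by omega⟩
  have hM0 : (0 : ℝ) ≤ M := Nat.cast_nonneg M
  have hNM : ((M + 2 : ℕ) : ℝ) = (M : ℝ) + 2 := by push_cast; ring
  have hN2 : (2 : ℝ) ≤ ((M + 2 : ℕ) : ℝ) := by rw [hNM]; linarith
  have hN0 : (0 : ℝ) < ((M + 2 : ℕ) : ℝ) := by linarith
  have hT₁ : (16 * |C| + 1) ^ (1 / (γ - 4 * θ)) ≤ ((M + 2 : ℕ) : ℝ) := by rw [hNM]; linarith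
  have hT₂ : (16 * Cjunk d a + 1) ^ (1 / (2 - 4 * θ)) ≤ ((M + 2 : ℕ) : ℝ) := by rw [hNM]; linarith
  -- the witness entry is dominated by the operator norm
  have hent := (norm_apply_le_norm (XW2 M μ₁ μ₂ a ha θ) (KW2 M μ₁ μ₂, μ₁) (KW2 M μ₁ μ₂, μ₁)).trans
    (opNorm_XW2_le h M hne ha)
  rw [XW2_entry M μ₁ μ₂ a ha θ, wθdSym_KW2_snd_eq, Gfor_diag, weight_mul_diag, main_KW2 M hne] at hent
  have hJ := junk_KW2_le M μ₁ μ₂ a ha hθ0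
  -- main term ≤ C/N^γ + Cj/N²
  have hmain : ((((1 : ℝ) / (2 * M + 3)) ^ 2) ^ θ) ^ 2 / 2
      ≤ C / ((M + 2 : ℕ) : ℝ) ^ γ + Cjunk d a / ((M + 2 : ℕ) : ℝ) ^ 2 := by
    have h1 := norm_sub_le
      (((((((1 : ℝ) / (2 * M + 3)) ^ 2) ^ θ) ^ 2 / 2 : ℝ) : ℂ)
        + ((‖wθdSym (2 * (M + 2)) θ (KW2 M μ₁ μ₂) (sWit2 μ₁ μ₂) μ₁‖ ^ 2 : ℝ) : ℂ)
          * (rEnt (2 * (M + 2)) a μ₁ μ₁ (sWit2 μ₁ μ₂) (KW2 M μ₁ μ₂) (KW2 M μ₁ μ₂)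
            - xEnt (2 * (M + 2)) a μ₁ (sWit2 μ₁ μ₂) (KW2 M μ₁ μ₂) (KW2 M μ₁ μ₂)))
      (((‖wθdSym (2 * (M + 2)) θ (KW2 M μ₁ μ₂) (sWit2 μ₁ μ₂) μ₁‖ ^ 2 : ℝ) : ℂ)
          * (rEnt (2 * (M + 2)) a μ₁ μ₁ (sWit2 μ₁ μ₂) (KW2 M μ₁ μ₂) (KW2 M μ₁ μ₂)
            - xEnt (2 * (M + 2)) a μ₁ (sWit2 μ₁ μ₂) (KW2 M μ₁ μ₂) (KW2 M μ₁ μ₂)))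
    rw [add_sub_cancel_right, Complex.norm_real, Real.norm_eq_abs,
      abs_of_nonneg (by positivity)] at h1
    linarith
  -- lower bound of the main term: ((1/(2M+3))²)^{2θ}/2 = (1/(2M+3))^{4θ}/2 ≥ (1/(2N))^{4θ}/2 ≥ 1/(8N^{4θ})
  have hW0 : (0 : ℝ) ≤ 1 / (2 * M + 3) := by positivity
  have hsq : ((((1 : ℝ) / (2 * M + 3)) ^ 2) ^ θ) ^ 2 = ((1 : ℝ) / (2 * M + 3)) ^ (4 * θ) := by
    rw [← Real.rpow_two, ← Real.rpow_two, ← Real.rpow_mul hW0, ← Real.rpow_mul hW0]; congr 1; ring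
  have hWN : 1 / (2 * ((M + 2 : ℕ) : ℝ)) ≤ (1 : ℝ) / (2 * M + 3) :=
    div_le_div_of_nonneg_left zero_le_one (by positivity) (by rw [hNM]; linarith)
  have hlow1 : 1 / (4 * ((M + 2 : ℕ) : ℝ) ^ (4 * θ)) ≤ ((1 : ℝ) / (2 * M + 3)) ^ (4 * θ) := by
    have h22 : (2 : ℝ) ^ (4 * θ) ≤ 4 :=
      calc (2 : ℝ) ^ (4 * θ) ≤ (2 : ℝ) ^ (2 : ℝ) :=
            Real.rpow_le_rpow_of_exponent_le (by norm_num) (by linarith)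
        _ = 4 := by rw [Real.rpow_two]; norm_num
    calc 1 / (4 * ((M + 2 : ℕ) : ℝ) ^ (4 * θ))
        ≤ 1 / ((2 * ((M + 2 : ℕ) : ℝ)) ^ (4 * θ)) := by
          refine div_le_div_of_nonneg_left zero_le_one (Real.rpow_pos_of_pos (by positivity) _) ?_
          rw [Real.mul_rpow (by norm_num) hN0.le]
          exact mul_le_mul_of_nonneg_right h22 (Real.rpow_nonneg hN0.le _)
      _ = (1 / (2 * ((M + 2 : ℕ) : ℝ))) ^ (4 * θ) := by
          rw [Real.div_rpow zero_le_one (by positivity), Real.one_rpow]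
      _ ≤ ((1 : ℝ) / (2 * M + 3)) ^ (4 * θ) := Real.rpow_le_rpow (by positivity) hWN (by linarith)
  have hlow : 1 / (8 * ((M + 2 : ℕ) : ℝ) ^ (4 * θ)) ≤ ((((1 : ℝ) / (2 * M + 3)) ^ 2) ^ θ) ^ 2 / 2 := by
    rw [hsq]
    have e : 1 / (8 * ((M + 2 : ℕ) : ℝ) ^ (4 * θ)) = (1 / (4 * ((M + 2 : ℕ) : ℝ) ^ (4 * θ))) / 2 := by
      rw [div_div]; ring_nf
    rw [e]
    linarith
  exact numeric_core8 hN2 hα hγ hCj (hlow.trans hmain) hT₁ hT₂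

/-- hence no constant works: `¬ ∃ C, OrderTwoOpRateResidualWθoff d a C θ γ` for `γ > 4θ`,
`0 ≤ θ < 1/2` (`d ≥ 2`, `a > 0`). [folklore] -/
theorem no_orderTwoOpRateWθoff_of_lt {μ₁ μ₂ : Fin d} (hne : μ₁ ≠ μ₂) (a : ℝ) (ha : 0 < a)
    {θ γ : ℝ} (hθ0 : 0 ≤ θ) (hθ2 : θ < 1 / 2) (hγ : 4 * θ < γ) :
    ¬ ∃ C, OrderTwoOpRateResidualWθoff d a C θ γ :=
  fun ⟨_, hC⟩ => not_orderTwoOpRateResidualWθoff_of_lt hne a ha hθ0 hθ2 hγ hC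

/-- in particular the UNWEIGHTED mixed residual (`θ = 0`, `ν ≠ ν′`) has no rate `N^{−γ}` for ANY
`γ > 0` (`d ≥ 2`). [folklore] -/
theorem not_orderTwoOpRateResidualWθoff_zero_of_pos {μ₁ μ₂ : Fin d} (hne : μ₁ ≠ μ₂) (a : ℝ)
    (ha : 0 < a) (C : ℝ) {γ : ℝ} (hγ : 0 < γ) : ¬ OrderTwoOpRateResidualWθoff d a C 0 γ :=
  not_orderTwoOpRateResidualWθoff_of_lt hne a ha le_rfl (by norm_num) (by linarith)

end NoGo

/-! ## §3 The mixed exponent `4θ` is sharp on `[0, 1/4]` [folklore] -/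

section Sharp

/-- **THE MIXED EXPONENT IS EXACTLY `4θ` FOR `0 ≤ θ ≤ 1/4` (`d ≥ 2`, `a > 0`):**
`(∃ C, OrderTwoOpRateResidualWθoff d a C θ γ) ↔ γ ≤ 4θ` — `⇐` by
`B5G183RateWThetaMixed.exists_orderTwoOpRateWθoff` (`min(4θ,1) = 4θ`), `⇒` by
`no_orderTwoOpRateWθoff_of_lt`.  Compare the all-directions law `γ ≤ 2θ`
(`B5G183RateWThetaHolds.orderTwoOpRateWθ_iff`). [cite: Balaban1984PropagatorsI, Prop. 1.1 (1.89) p.33;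
King1986, (4.20), (4.23) p.672] [folklore] -/
theorem orderTwoOpRateWθoff_iff {μ₁ μ₂ : Fin d} (hne : μ₁ ≠ μ₂) {a : ℝ} (ha : 0 < a) {θ γ : ℝ}
    (hθ0 : 0 ≤ θ) (hθ : θ ≤ 1 / 4) : (∃ C, OrderTwoOpRateResidualWθoff d a C θ γ) ↔ γ ≤ 4 * θ := by
  constructor
  · intro h
    by_contra hlt
    exact no_orderTwoOpRateWθoff_of_lt hne a ha hθ0 (by linarith) (lt_of_not_ge hlt) h
  · intro hγ
    exact exists_orderTwoOpRateWθoff d ha hθ0 (by linarith)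
      (le_min hγ (by linarith))

/-- **summary of the two exponent laws for `0 < θ ≤ 1/4` (`d ≥ 2`, `a > 0`):** all directions
`γ ≤ 2θ`, mixed directions `γ ≤ 4θ`. [folklore] -/
theorem mixed_exponent_summary {μ₁ μ₂ : Fin d} (hne : μ₁ ≠ μ₂) {a : ℝ} (ha : 0 < a) {θ γ : ℝ}
    (hθ0 : 0 ≤ θ) (hθ : θ ≤ 1 / 4) :
    ((∃ C, OrderTwoOpRateResidualWθ d a C θ γ) ↔ γ ≤ 2 * θ)
      ∧ ((∃ C, OrderTwoOpRateResidualWθoff d a C θ γ) ↔ γ ≤ 4 * θ) :=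
  ⟨orderTwoOpRateWθ_iff μ₁ ha hθ0 (by linarith), orderTwoOpRateWθoff_iff hne ha hθ0 hθ⟩

end Sharp

end Literature.MathematicalPhysics.QuantumFieldTheory.Balaban1983to89.B5G183RateWThetaMixedSharp
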